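import Mathlib
import HarnessLib
import Summits.HubbardSuperconductivity.HubbardSuperconductivity.Theorems.KLProgrammeKLRegimeSplitPairValueBridge

/-!
# Route `KLProgramme` — K3 child `KLRegimeBetaSplit` (stmt-HubbardSuperconductivity-19635), line `birth`, Stub 1:
# the running coupling VALUE line in the spin pattern `(0,1)` from (B1-v2) `PairArrayAt` alone

Supplier row «`QuarticValueLine` ⇐ `PairArrayAt`» of the V3 map (`KLProgrammeKLRegimeSplitPredicatesV3`), every configuration:
(B1-v2) `PairArrayAt … n` speaks about EVERY total lattice momentum `Q`, so for momenta `k₁, k₂, k₃` of the ball one takes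
`Q := k₁ + k₃` (then `Q − k₁ = k₃`) in the bridge `quarticValue_pair_le_of_pairArrayAt` (p443794):
`|λ_n^{01}(k₁,k₂,k₃)| = |𝒞_n(k₁+k₃; k₂, k₁)| ≤ 2|U| + C_W·U²`.  No increment clause is consumed.  Cell gate-hubbard-kl, seat
hubbard-kl-r2d-p1 (g0); registered stub of the skeleton `Lines/birth.lean` of 19635 (evidence `KLRegimeBetaSplit.lean`).
-/

noncomputable section

namespace Summit.HubbardSuperconductivity.HubbardSuperconductivity.Theorems.KLRegimeSplit

set_option linter.dupNamespace false -- summit = problem name (single-conjunct summit), D-0017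

open Literature.MathematicalPhysics.QuantumLattice Literature.Probability.LatticeModels
open Summit.HubbardSuperconductivity.HubbardSuperconductivity.Theorems.KLProgrammeLegKernels

/-- **Stub 1 of line `birth` (child `KLRegimeBetaSplit`): the `(0,1)`-pattern value line from (B1-v2).**  If `PairArrayAt … n`
holds then `‖λ_n^{01}(k₁,k₂,k₃)‖ ≤ 2|U| + C_W·U²` for all momenta `k₁, k₂, k₃` of the ultraviolet ball (`Q := k₁ + k₃` in
(B1-v2); `klQuarticValue_pair`). -/
theorem stub_quarticValueLine01 :
    ∀ (L M : ℕ) [NeZero L] [NeZero M] (P : SplitConsts) (β U μ : ℝ) (K : TrigPolyC4v) (n : ℕ),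
      PairArrayAt L M P β U μ K n →
        ∀ k₁ ∈ klBall L μ K, ∀ k₂ ∈ klBall L μ K, ∀ k₃ ∈ klBall L μ K,
          ‖klQuarticValue L M β U μ K n 0 1 k₁ k₂ k₃‖ ≤ 2 * |U| + P.C_W * U ^ 2 := by
  intro L M _ _ P β U μ K n h k₁ hk₁ k₂ hk₂ k₃ _
  have hQ : k₁ + k₃ - k₁ = k₃ := add_sub_cancel_left k₁ k₃
  have := quarticValue_pair_le_of_pairArrayAt L M P h (k₁ + k₃) hk₂ hk₁
  rwa [hQ] at this

end Summit.HubbardSuperconductivity.HubbardSuperconductivity.Theorems.KLRegimeSplit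

end
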